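import Literature.Probability.RandomPlanarGeometry.SLETraceKappaLimit
import Literature.Probability.RandomPlanarGeometry.DrivingFunctionMeasurable
import Literature.Probability.RandomPlanarGeometry.CritPercSLE
import Mathlib.Topology.UniformSpace.HeineCantor
import HarnessLib

/-!
# `stub_sleCont` — uniform-continuity quantile of the SLE(8/3) reference curve (crux
`PathUpgradeR`, stmt-CriticalPhenomena-18055, route `SAWReversalUpgrade`, line `bidir_windows`)

Landing target:
`Summits/CriticalPhenomena/SAWScalingLimit/Theorems/SAWReversalUpgradePathUpgradeRSLECont.lean`
(`--supports stmt-CriticalPhenomena-18055`; registered stub `stub_sleCont`).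

The registered theorem `stub_sleCont` is one of the "quantile lemmas" on the SLE(8/3) reference
sample `γ = sleTrace (8/3) ω` seen in a Dobrushin domain `E` through the boundary extension `ψ̄`
of a chordal uniformizer `ψ : ℍ ≃ E`: for every time horizon `T`, oscillation size `ν > 0` and
budget `β > 0` there is a deterministic `c > 0` such that the event "two times `s, t ≤ T + 1`
with `|s - t| ≤ c` have `|ψ̄ (γ s) - ψ̄ (γ t)| ≥ ν`" has `preWienerMeasure`-probability `≤ β`.

Proof (sub-namespace `PathUpgradeRSLERegCont`, for a general continuous `Φ : ℂ → ℂ` in place of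
`ψ̄ ∘ liftIm 0` and a general `κ`):
* `isOpen_setOf_osc` / `measurableSet_osc`: the strict-inequality oscillation event
  `{∃ s t ≤ T', |s - t| < c, ν' < |Φ (γ s) - Φ (γ t)|}` is the preimage of an open set of paths
  under the Borel measurable random continuous path `measurable_sleTracePath`;
* `exists_not_osc`: for EVERY sample point, `Φ ∘ γ` is uniformly continuous on the compact
  `[0, T']` (Heine–Cantor), so the event with `c = 1/(n+1)`, `ν' = ν/2` fails for large `n`;
* `exists_measure_osc_le`: the events decrease in `n` to a set of measure zero, continuity from
  above (`tendsto_measure_iInter_atTop`) gives an `n` with probability `≤ β`, and the registered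
  (non-strict) event with `c = 1/(n+2)` is contained in it (`measure_mono`).
-/

noncomputable section

open scoped ENNReal NNReal Topology
open MeasureTheory Filter Set Metric TopologicalSpace
open Literature.Probability Literature.Probability.RandomPlanarGeometry
open UpperHalfPlane (upperHalfPlaneSet)

namespace Summit.CriticalPhenomena.SAWScalingLimit.Theorems

namespace PathUpgradeRSLERegCont

open scoped PathBorel

/-- The set of continuous paths `f : [0, ∞) → ℂ` admitting two times `s, t ≤ T'` with
`|s - t| < c` and `ν' < |Φ (f s) - Φ (f t)|` is open in `C([0, ∞), ℂ)` (compact-open topology)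
for continuous `Φ`: it is a union over `(s, t)` of preimages of open sets under the continuous
evaluations. [folklore] -/
theorem isOpen_setOf_osc {Φ : ℂ → ℂ} (hΦ : Continuous Φ) (T' c ν' : ℝ) :
    IsOpen {f : C(ℝ≥0, ℂ) | ∃ s t : ℝ≥0, (s : ℝ) ≤ T' ∧ (t : ℝ) ≤ T' ∧ |(s : ℝ) - t| < c ∧
      ν' < dist (Φ (f s)) (Φ (f t))} := by
  have hrep : {f : C(ℝ≥0, ℂ) | ∃ s t : ℝ≥0, (s : ℝ) ≤ T' ∧ (t : ℝ) ≤ T' ∧ |(s : ℝ) - t| < c ∧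
      ν' < dist (Φ (f s)) (Φ (f t))} = ⋃ s : ℝ≥0, ⋃ t : ℝ≥0,
      ⋃ (_ : (s : ℝ) ≤ T' ∧ (t : ℝ) ≤ T' ∧ |(s : ℝ) - t| < c),
        {f : C(ℝ≥0, ℂ) | ν' < dist (Φ (f s)) (Φ (f t))} := by
    ext f
    simp only [mem_setOf_eq, mem_iUnion, exists_prop, and_assoc]
  rw [hrep]
  exact isOpen_iUnion fun s ↦ isOpen_iUnion fun t ↦ isOpen_iUnion fun _ ↦
    isOpen_lt continuous_const ((hΦ.comp (continuous_eval_const s)).dist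
      (hΦ.comp (continuous_eval_const t)))

/-- Measurability of the (strict) oscillation event of `Φ ∘ γ`, `γ = sleTrace κ ω` the SLE_κ
trace: it is the preimage of the open set of paths `isOpen_setOf_osc` under the Borel measurable
random continuous path `measurable_sleTracePath`. [folklore] -/
theorem measurableSet_osc (κ : ℝ≥0) {Φ : ℂ → ℂ} (hΦ : Continuous Φ) (T' c ν' : ℝ) :
    MeasurableSet {ω : ℝ≥0 → ℝ | ∃ s t : ℝ≥0, (s : ℝ) ≤ T' ∧ (t : ℝ) ≤ T' ∧
      |(s : ℝ) - t| < c ∧ ν' < dist (Φ (sleTrace κ ω s)) (Φ (sleTrace κ ω t))} :=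
  (isOpen_setOf_osc hΦ T' c ν').measurableSet.preimage (measurable_sleTracePath κ)

/-- Heine–Cantor, for every sample point: `Φ ∘ γ` (`Φ` continuous, `γ = sleTrace κ ω`
continuous) is uniformly continuous on the compact time interval `[0, T']`, so for `ν' > 0` some
`n` admits no two times `s, t ≤ T'` with `|s - t| < 1/(n+1)` and `ν' < |Φ (γ s) - Φ (γ t)|`.
[folklore] -/
theorem exists_not_osc (κ : ℝ≥0) (ω : ℝ≥0 → ℝ) {Φ : ℂ → ℂ} (hΦ : Continuous Φ) (T' : ℝ)
    {ν' : ℝ} (hν' : 0 < ν') :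
    ∃ n : ℕ, ¬ ∃ s t : ℝ≥0, (s : ℝ) ≤ T' ∧ (t : ℝ) ≤ T' ∧ |(s : ℝ) - t| < 1 / ((n : ℝ) + 1) ∧
      ν' < dist (Φ (sleTrace κ ω s)) (Φ (sleTrace κ ω t)) := by
  have hc : Continuous fun u ↦ Φ (sleTrace κ ω u) := hΦ.comp (continuous_sleTrace κ ω)
  have hK : IsCompact (Icc (0 : ℝ≥0) (Real.toNNReal T')) := isCompact_Icc
  have hmemK : ∀ u : ℝ≥0, (u : ℝ) ≤ T' → u ∈ Icc (0 : ℝ≥0) (Real.toNNReal T') := fun u hu ↦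
    ⟨zero_le, by
      rw [← Real.toNNReal_coe (r := u)]
      exact Real.toNNReal_le_toNNReal hu⟩
  obtain ⟨δ, hδ, hδc⟩ := Metric.uniformContinuousOn_iff.1
    (hK.uniformContinuousOn_of_continuous hc.continuousOn) ν' hν'
  obtain ⟨n, hn⟩ := exists_nat_one_div_lt hδ
  refine ⟨n, ?_⟩
  rintro ⟨s, t, hs, ht, hst, hd⟩
  have h := hδc s (hmemK s hs) t (hmemK t ht) (by rw [NNReal.dist_eq]; exact hst.trans hn)
  exact absurd hd (not_lt.2 h.le)

/-- **The quantile lemma** (general continuous `Φ`, general `κ`): for `ν > 0` and `β ≠ 0` there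
is `c > 0` with `P' {∃ s t ≤ T', |s - t| ≤ c, ν ≤ |Φ (γ s) - Φ (γ t)|} ≤ β`. The strict events
`B n = {∃ s t ≤ T', |s - t| < 1/(n+1), ν/2 < |Φ (γ s) - Φ (γ t)|}` are measurable
(`measurableSet_osc`), decrease in `n`, and have empty intersection (`exists_not_osc`); by
continuity from above some `B n` has probability `< β`, and the event with `c = 1/(n+2)` is
contained in `B n` (the measure of a non-measurable set is its outer measure, `measure_mono`).
[folklore] -/
theorem exists_measure_osc_le (κ : ℝ≥0) {Φ : ℂ → ℂ} (hΦ : Continuous Φ) (T' : ℝ) {ν : ℝ}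
    (hν : 0 < ν) {β : ℝ≥0∞} (hβ : β ≠ 0) :
    ∃ c : ℝ, 0 < c ∧ Process.preWienerMeasure {ω | ∃ s t : ℝ≥0, (s : ℝ) ≤ T' ∧ (t : ℝ) ≤ T' ∧
      |(s : ℝ) - t| ≤ c ∧ ν ≤ dist (Φ (sleTrace κ ω s)) (Φ (sleTrace κ ω t))} ≤ β := by
  haveI : IsProbabilityMeasure Process.preWienerMeasure := isProbabilityMeasure_preWienerMeasure'
  obtain ⟨B, hBmem⟩ : ∃ B : ℕ → Set (ℝ≥0 → ℝ), ∀ n ω, ω ∈ B n ↔ ∃ s t : ℝ≥0, (s : ℝ) ≤ T' ∧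
      (t : ℝ) ≤ T' ∧ |(s : ℝ) - t| < 1 / ((n : ℝ) + 1) ∧
        ν / 2 < dist (Φ (sleTrace κ ω s)) (Φ (sleTrace κ ω t)) :=
    ⟨fun n ↦ {ω | ∃ s t : ℝ≥0, (s : ℝ) ≤ T' ∧ (t : ℝ) ≤ T' ∧ |(s : ℝ) - t| < 1 / ((n : ℝ) + 1) ∧
      ν / 2 < dist (Φ (sleTrace κ ω s)) (Φ (sleTrace κ ω t))}, fun _ _ ↦ Iff.rfl⟩
  have hBdef : ∀ n, B n = {ω | ∃ s t : ℝ≥0, (s : ℝ) ≤ T' ∧ (t : ℝ) ≤ T' ∧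
      |(s : ℝ) - t| < 1 / ((n : ℝ) + 1) ∧
        ν / 2 < dist (Φ (sleTrace κ ω s)) (Φ (sleTrace κ ω t))} :=
    fun n ↦ Set.ext (hBmem n)
  have hBm : ∀ n, MeasurableSet (B n) := fun n ↦ by
    rw [hBdef]
    exact measurableSet_osc κ hΦ T' _ _
  have hanti : Antitone B := fun n n' hnn' ω hω ↦ by
    obtain ⟨s, t, hs, ht, hst, hd⟩ := (hBmem n' ω).1 hω
    exact (hBmem n ω).2 ⟨s, t, hs, ht, hst.trans_le (one_div_le_one_div_of_le
      (Nat.cast_add_one_pos n) (by exact_mod_cast Nat.succ_le_succ hnn')), hd⟩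
  have hnull : Process.preWienerMeasure (⋂ n, B n) = 0 := by
    rw [measure_eq_zero_iff_ae_notMem]
    refine ae_of_all _ fun ω hmem ↦ ?_
    obtain ⟨n, hn⟩ := exists_not_osc κ ω hΦ T' (half_pos hν)
    exact hn ((hBmem n ω).1 (mem_iInter.1 hmem n))
  have htend := tendsto_measure_iInter_atTop (μ := Process.preWienerMeasure)
    (fun n ↦ (hBm n).nullMeasurableSet) hanti ⟨0, measure_ne_top _ _⟩
  rw [hnull] at htend
  obtain ⟨n, hn⟩ := (htend.eventually_lt_const (pos_iff_ne_zero.2 hβ)).exists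
  refine ⟨1 / ((n : ℝ) + 2), by positivity, (measure_mono ?_).trans hn.le⟩
  rintro ω ⟨s, t, hs, ht, hst, hd⟩
  exact (hBmem n ω).2 ⟨s, t, hs, ht, hst.trans_lt (one_div_lt_one_div_of_lt
    (Nat.cast_add_one_pos n) (by linarith)), (half_lt_self hν).trans_le hd⟩

end PathUpgradeRSLERegCont

/-- **Uniform-continuity quantile of the SLE(8/3) reference curve in `E`** (registered stub
`stub_sleCont` of crux `PathUpgradeR`, line `bidir_windows`): for a chordal uniformizer
`ψ : ℍ ≃ E` of a Dobrushin domain, a horizon `T`, an oscillation size `ν > 0` and a budget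
`β > 0`, some deterministic `c > 0` makes the event "two times `s, t ≤ T + 1` with `|s - t| ≤ c`
and `ν ≤ |ψ̄ (γ s) - ψ̄ (γ t)|`" (`γ = sleTrace (8/3) ω`, `ψ̄` the boundary extension) have
`preWienerMeasure`-probability `≤ β`. This is `PathUpgradeRSLERegCont.exists_measure_osc_le` for
the continuous `Φ = ψ̄ ∘ liftIm 0` (`continuous_boundaryExtension_liftIm`), which agrees with `ψ̄`
on the trace (`sleTrace_im_nonneg`). [folklore] -/
theorem stub_sleCont : ∀ (E : Literature.Probability.RandomPlanarGeometry.DobrushinDomain) (ψ : Literature.Probability.RandomPlanarGeometry.ConformalEquiv UpperHalfPlane.upperHalfPlaneSet E.carrier), E.IsChordalUniformizing ψ → ∀ (T : NNReal) (ν : ℝ), 0 < ν → ∀ β : ENNReal, 0 < β → ∃ c : ℝ, 0 < c ∧ Literature.Probability.Process.preWienerMeasure {ω | ∃ s t : NNReal, (s : ℝ) ≤ T + 1 ∧ (t : ℝ) ≤ T + 1 ∧ |(s : ℝ) - t| ≤ c ∧ ν ≤ dist (ψ.boundaryExtension (Literature.Probability.RandomPlanarGeometry.sleTrace ((8:NNReal)/3)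 ω s)) (ψ.boundaryExtension (Literature.Probability.RandomPlanarGeometry.sleTrace ((8:NNReal)/3) ω t))} ≤ β := by
  intro E ψ _ T ν hν β hβ
  have hfeq : ∀ (ω : ℝ≥0 → ℝ) (t : ℝ≥0),
      ψ.boundaryExtension (Loewner.liftIm 0 (sleTrace ((8 : ℝ≥0) / 3) ω t)) =
        ψ.boundaryExtension (sleTrace ((8 : ℝ≥0) / 3) ω t) := fun ω t ↦ by
    rw [Loewner.liftIm_of_le (sleTrace_im_nonneg _ ω t)]
  obtain ⟨c, hc, hle⟩ := PathUpgradeRSLERegCont.exists_measure_osc_le ((8 : ℝ≥0) / 3)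
    (continuous_boundaryExtension_liftIm ψ) ((T : ℝ) + 1) hν hβ.ne'
  refine ⟨c, hc, (measure_mono ?_).trans hle⟩
  rintro ω ⟨s, t, hs, ht, hst, hd⟩
  exact ⟨s, t, hs, ht, hst, by simpa only [hfeq] using hd⟩

end Summit.CriticalPhenomena.SAWScalingLimit.Theorems

end
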